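import Literature.MathematicalPhysics.QuantumFieldTheory.Balaban1983to89.BlockAveragingEMLProp2
import Literature.MathematicalPhysics.QuantumFieldTheory.Balaban1983to89.LatticeFieldCalculus

/-!
# `Balaban1983to89.BlockAveragingEMLLinearised` — [Balaban1985Averaging] PROPOSITION 3 (121)–(125) AT THE FLAT BACKGROUND `V₀ = 1`
# FOR THE SYMMETRIC BLOCK AVERAGING (0.4) OF [Balaban1987RG1] WITH THE PRINTED `exp[mean log]` ON `SU(N)`: the averaged configuration to
# FIRST ORDER in the bond variables `Y_b = U_b − 1`, with an explicit second-order remainder — PROVED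

T. Bałaban, *Averaging operations for lattice gauge theories*, Commun. Math. Phys. **98** (1985) 17–51 [Balaban1985Averaging] (cell paper B7;
held `paper:balaban1985-cmp98-averaging`, journal page = PDF page + 16), Proposition 3 p. 36 [PDF 20], verbatim: *«Let us define
Q(V₀, A, c) = (1/i) log(V̿₁)_c, (121) then Q(V₀, A, c) is an analytic function of A and from (120) it follows that its Taylor expansion begins
with a first-order polynomial. Let us denote it by L(Q(V₀)A)_c, thus Q(V₀, A, c) = L(Q(V₀)A)_c + C(V₀, A, c). (122)  C(V₀, A, c) is an analytic
function of A whose Taylor's expansion begins with a second-order polynomial (a quadratic form), and |C(V₀, A, c)| ≦ C₁L²|A|² < C₁(Lα₁)². (123)»*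
and *«The first term on the right-hand side above is the main term in this linear form … (Q₀A)_c = (Q_{V₀}A)_c = Σ_{x∈B(c₋)} L^{−d+1}(R_{0,c₋}A)([x, x′]), (125)»*
(`R_{0,y}` = the passage to the radial axial gauge of the block `B(y)`, (58) p. 27).  T. Bałaban, *Renormalization group approach to lattice gauge
field theories. I*, Commun. Math. Phys. **109** (1987) 249–301 [Balaban1987RG1], (0.3)–(0.4) pp. 252–253 and p. 253, verbatim: *«The considerations
and results of this, and previous papers, do not depend on any particular averaging operation used; they are valid universally for all averages
satisfying the above properties.»*

Fleet seat `ym-ust-19200-p2` (gen 2; `--supports stmt-QuantumFields-19200`, route `UnitScaleTilt`, crux K1 child «MinimiserStabilityRegPr», leaf V3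
`stub_prop7From14` = [Balaban1985Variational] Prop 7 from a background (14), sub-lemma **V3-D1c** of the seat ym-ust-19200-p1's split card
(evidence #27∕#29 on the item): «identification `Q := d(descendTo F ℰp n K)_1 = M + G` — the linearisation of the averaging OF RECORD»).

WHY THIS FILE EXISTS.  The tree certifies Prop. 3 for [B7]'s OWN one-family average (42) on `ℤᵈ` (`B7Prop3Flat.prop3_flat`, `B7Eq123General`,
`B7ConclOneStep`), whose carrier (`B7Prop1Explicit.bavg`: corner-based blocks, one tree word per site, no symmetrisation, `𝔸ˣ`-valued on `ℤᵈ`) is NOT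
the averaging of record of the T³∕T⁴ programmes — [I]'s symmetric (0.3)–(0.4) `BlockAveraging.blockAvg ExpMeanLog.expMeanLogSU` on the torus
(centred blocks, all orderings `σ, σ′` of the staircases, the guarded `exp[mean log]` on `SU(N)`).  The sibling `BlockAveragingEMLProp2` proved
Props. 1–2 for (0.4); this file proves the FLAT-BACKGROUND CASE OF PROP. 3 for (0.4): the one-step average `Ū = avgFun ℰp U` expanded to first order
in the bond variables `Y_b = U_b − 1` (the programme's exp-free chart), with the remainder (123) explicit.

THE STATEMENT (§4, `norm_avgFun_sub_one_sub_linAvg_le`).  Let `ℓ = (d+2)L` (the bound `LatticeWordStokes.length_loopWord_le` on the loop words of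
(0.4)).  If every bond variable satisfies `‖U_b − 1‖ ≤ δ` with `16ℓδ ≤ 1` and `2ℓδ < δ_N` (`δ_N = min(1/3, π/N)`, the guard of `expMeanLogSU`), then for
every coarse bond `c = ⟨y, y + e_μ⟩`

  `‖Ū(c) − 1 − (Q₁Y)(c)‖ ≤ 81·(ℓδ)²`,   `(Q₁Y)(c) = |I|⁻¹ Σ_{(n,σ,σ′)∈I} [ Y(Γ^σ_{y→x}) + Y([x, x′]) − Y(Γ^{σ′}_{y′→x′}) ]`   (`linAvg`)

(`x = y + n` runs over `B(y)`, `x′ = x + Le_μ`, `y′ = y + e_μ`; `Y(Γ)` = the signed sum of `Y` along the walk `Γ`, `walkSum`; `I = Idx P` the uniform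
index set of (0.4)).  READING OF (124)–(125): the middle term is the MAIN TERM `L·(QY)(c) = Σ_{x∈B(c₋)} L^{−d} Y([x, x′])` (the straight-line block
average of the tree, `LatticeFieldCalculus.bondAvg`, times `L`); the two staircase terms are the block-axial-gauge corrections: with
`λ(z) := |S_d|⁻¹ Σ_σ Y(Γ^σ_{centre(z)→z})` one has `Y(Γ^σ_{y→x}) + Y([x,x′]) − Y(Γ^{σ′}_{y′→x′})` averaged `= (Y − dλ)([x, x′])` averaged, i.e.
`Q₁Y = L·Q(R₀Y)` with `R₀Y = Y − dλ` the (ordering-symmetrised) radial-axial representative of `Y` — exactly (125) at `V₀ = 1`, where print writes the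
main term on `R_{0,c₋}A`.  In particular `Q₁(dλ) = 0` for every `λ` vanishing at the block centres (the average is invariant under gauge
transformations trivial on the coarse lattice), while `Q₁ ≠ L·Q` on general `Y`.

THE MECHANISM.  `Ū(c) = κ_c·U(c)` with `κ_c = exp[|I|⁻¹ Σ_i log W_i]` within `6θ²` of `1 + |I|⁻¹Σ_i(W_i − 1)` (`BlockAveragingEMLProp2.norm_corr_sub_mean_le`,
`θ = 2ℓδ`); each loop variable factorises `W_i = A_i·B_i·C_i⁻¹·U(c)⁻¹` (`BlockAveragingEMLProp2.loopHol_eq`: staircase from `y`, straight line from `x`,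
staircase from `y′`, the bond backwards); a product of near-`1` factors is the sum of its `(factor − 1)` to second order (§1), `C⁻¹ − 1 = −(C − 1)` and
`U(c)⁻¹ − 1 = −(U(c) − 1)` to second order (unitarity), each segment holonomy is `1 +` the signed sum of the `Y_b` along it to second order (§3), and
the `U(c)`-terms of `κ_c` and of the factor `U(c)` CANCEL exactly at first order — no expansion of `U(c)` is needed.

WHAT IS PROVED (kernel; 2 `def`s — `walkSum`, `linAvg` —, 0 `sorry`; every cited input BY NAME).
* §1 private letters in a normed ring: `norm_prod_sub_one_le`, `norm_prod_sub_one_sub_sum_le` (as in the sibling), the numeric envelopes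
  `one_add_pow_sub_one_le`, `one_add_pow_sub_one_sub_mul_le` (`(1+b)^m − 1 − mb ≤ m²b²(1+b)^m`), `one_add_pow_le_two`, `norm_mean_le`, `mean_const`.
* §2 `walkSum` (signed sum of a bond field along a walk) with `walkSum_nil/cons/append`, `length_walk`.
* §3 `SU(N)` holonomies to first order: `coe_holAt_eq_prod` (`stepFactor`), private `norm_star_sub_one_add_le` (`‖U⁻¹ − 1 + (U − 1)‖ ≤ ‖U − 1‖²`),
  `norm_holAt_sub_one_le`, **`norm_holAt_sub_one_sub_walkSum_le`** (`‖U(Γ) − 1 − Y(Γ)‖ ≤ (1+δ)^m − 1 − mδ + mδ²`, `m = |Γ|`).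
* §4 `norm_holAt_sub_one(_sub_walkSum)_le_of_length_le` (segments of `≤ m` steps: `2mδ`, `3m²δ²`), `linAvg`, `length_walk_stairWord_le`,
  `loop_first_order_le` (per loop index: `49(ℓδ)²`) and **`norm_avgFun_sub_one_sub_linAvg_le`** (the statement above).

* §5 (v1.1, APPEND-ONLY) **THE MAIN TERM IDENTIFIED**: `walkSum_grad` (telescoping `(dλ)(Γ) = λ(end) − λ(start)`), `walkSum_walk_replicate`
  (straight walks = the tree's `LatticeFieldCalculus.segSum`), `walkEnd_emb_stairWord_eq_blockSite`, the block mean of the comb sums `combMean`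
  (`λ̄_Y(y) = |I|⁻¹ Σ_{(n,σ,σ′)} Y(Γ^σ_{y→y+n})`, the linearisation of [B7] (62) `v(y)`), and **`linAvg_eq_bondAvg_sub_grad_combMean`**:
  `Q₁Y (c) = L·(QY)(c) − (λ̄_Y(c₊) − λ̄_Y(c₋))` with `Q = LatticeFieldCalculus.bondAvg` the straight-line block average OF RECORD ([Balaban1984PropagatorsI]
  (1.11), `bondAvgIter` (1.18)) — the linearised (0.4) average IS the straight-line average up to the coarse GRADIENT of the block-averaged comb
  potential (print: the coarse gauge transformation `v` of (62)–(63)∕(93) factored out of `V̄₁V̄₀⁻¹` before (121) defines `Q(V₀, A)` on the double-bar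
  average); `linAvg_grad` (`Q₁(dλ)(c) = λ(emb c₊) − λ(emb c₋)`: linearised covariance under fine gauge transformations).

HONEST FRAMING.  A kernel proof of the flat-background case of one printed proposition of [B7] for the averaging the programmes actually use
([I] (0.4)); the general-background case (121)–(124) (conjugations `R(V₀(Γ_{y,b₋}))`, the `O(L²α₀)` terms) and the `k`-fold Prop. 4 are NOT here.
It asserts nothing else of Bałaban's, proves no summit statement, moves no count; one finite torus at fixed level.  New sibling module of
`BlockAveragingEMLProp2`; nothing in the tree is modified.
-/

noncomputable section

open scoped BigOperators

namespace Literature.MathematicalPhysics.QuantumFieldTheory.Balaban1983to89.BlockAveragingEMLLinearised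

/-! ## §1 Second-order letters in a normed ring -/

section Algebra

variable {𝔸 : Type*} [NormedRing 𝔸]

/-- `‖∏ xᵢ − 1‖ ≤ (1+b)^m − 1` for a list of `m` elements within `b` of `1`. [folklore] -/
private theorem norm_prod_sub_one_le (b : ℝ) (hb : 0 ≤ b) :
    ∀ l : List 𝔸, (∀ x ∈ l, ‖x - 1‖ ≤ b) → ‖l.prod - 1‖ ≤ (1 + b) ^ l.length - 1
  | [], _ => by simp
  | x :: l, h => by
    have hx : ‖x - 1‖ ≤ b := h x (by simp)
    have ih := norm_prod_sub_one_le b hb l fun y hy => h y (by simp [hy])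
    have hP : 0 ≤ (1 + b) ^ l.length - 1 := by
      have : (1 : ℝ) ≤ (1 + b) ^ l.length := one_le_pow₀ (by linarith)
      linarith
    rw [List.prod_cons, List.length_cons]
    have e : x * l.prod - 1 = (x - 1) * (l.prod - 1) + (x - 1) + (l.prod - 1) := by noncomm_ring
    rw [e]
    calc ‖(x - 1) * (l.prod - 1) + (x - 1) + (l.prod - 1)‖
        ≤ ‖x - 1‖ * ‖l.prod - 1‖ + ‖x - 1‖ + ‖l.prod - 1‖ :=
          (norm_add_le _ _).trans (add_le_add ((norm_add_le _ _).trans (add_le_add (norm_mul_le _ _) le_rfl)) le_rfl)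
      _ ≤ b * ((1 + b) ^ l.length - 1) + b + ((1 + b) ^ l.length - 1) := by gcongr
      _ = (1 + b) ^ (l.length + 1) - 1 := by ring

/-- **Products of near-`1` elements to second order**: `‖∏ xᵢ − 1 − Σ (xᵢ − 1)‖ ≤ (1+b)^m − 1 − m·b` for a list of `m`
elements within `b` of `1`. [folklore] -/
private theorem norm_prod_sub_one_sub_sum_le (b : ℝ) (hb : 0 ≤ b) :
    ∀ l : List 𝔸, (∀ x ∈ l, ‖x - 1‖ ≤ b) →
      ‖l.prod - 1 - (l.map (· - 1)).sum‖ ≤ (1 + b) ^ l.length - 1 - l.length * b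
  | [], _ => by simp
  | x :: l, h => by
    have hx : ‖x - 1‖ ≤ b := h x (by simp)
    have h' : ∀ y ∈ l, ‖y - 1‖ ≤ b := fun y hy => h y (by simp [hy])
    have ih := norm_prod_sub_one_sub_sum_le b hb l h'
    have ih₁ := norm_prod_sub_one_le b hb l h'
    have hP : 0 ≤ (1 + b) ^ l.length - 1 := by
      have : (1 : ℝ) ≤ (1 + b) ^ l.length := one_le_pow₀ (by linarith)
      linarith
    rw [List.prod_cons, List.length_cons, List.map_cons, List.sum_cons]
    have e : x * l.prod - 1 - ((x - 1) + (l.map (· - 1)).sum) =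
        (x - 1) * (l.prod - 1) + (l.prod - 1 - (l.map (· - 1)).sum) := by noncomm_ring
    rw [e]
    calc ‖(x - 1) * (l.prod - 1) + (l.prod - 1 - (l.map (· - 1)).sum)‖
        ≤ ‖x - 1‖ * ‖l.prod - 1‖ + ‖l.prod - 1 - (l.map (· - 1)).sum‖ :=
          (norm_add_le _ _).trans (add_le_add (norm_mul_le _ _) le_rfl)
      _ ≤ b * ((1 + b) ^ l.length - 1) + ((1 + b) ^ l.length - 1 - l.length * b) := by gcongr
      _ = (1 + b) ^ (l.length + 1) - 1 - ((l.length + 1 : ℕ) : ℝ) * b := by push_cast; ring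

/-- `(1+b)^m − 1 ≤ m·b·(1+b)^m` (`b ≥ 0`). [folklore] -/
private theorem one_add_pow_sub_one_le (b : ℝ) (hb : 0 ≤ b) : ∀ m : ℕ, (1 + b) ^ m - 1 ≤ m * b * (1 + b) ^ m
  | 0 => by simp
  | m + 1 => by
    have ih := one_add_pow_sub_one_le b hb m
    have h1 : (1 : ℝ) ≤ (1 + b) ^ (m + 1) := one_le_pow₀ (by linarith)
    have hm : (0 : ℝ) ≤ m := Nat.cast_nonneg m
    have hp : (0 : ℝ) ≤ (1 + b) ^ m := pow_nonneg (by linarith) m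
    push_cast
    rw [pow_succ]
    nlinarith [mul_nonneg (mul_nonneg hm hb) hp, mul_nonneg hb hp]

/-- `(1+b)^m − 1 − m·b ≤ m²·b²·(1+b)^m` (`b ≥ 0`): the second-order envelope of a product of `m` near-`1` factors. [folklore] -/
private theorem one_add_pow_sub_one_sub_mul_le (b : ℝ) (hb : 0 ≤ b) :
    ∀ m : ℕ, (1 + b) ^ m - 1 - m * b ≤ (m : ℝ) ^ 2 * b ^ 2 * (1 + b) ^ m
  | 0 => by simp
  | m + 1 => by
    have ih := one_add_pow_sub_one_sub_mul_le b hb m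
    have ih₁ := one_add_pow_sub_one_le b hb m
    have h1 : (1 : ℝ) ≤ (1 + b) ^ (m + 1) := one_le_pow₀ (by linarith)
    have hm : (0 : ℝ) ≤ m := Nat.cast_nonneg m
    have hp : (1 : ℝ) ≤ (1 + b) ^ m := one_le_pow₀ (by linarith)
    push_cast
    rw [pow_succ]
    nlinarith [mul_nonneg (mul_nonneg hm hb) (mul_nonneg hb (sub_nonneg.2 hp)), mul_nonneg hm (mul_nonneg hb hb),
      mul_nonneg (mul_nonneg hb hb) (sub_nonneg.2 hp)]

/-- `(1+b)^m ≤ 2` when `m·b ≤ ½` (`b ≥ 0`; via `1 + b ≤ e^b` and `e^{1/2} ≤ 2`). [folklore] -/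
private theorem one_add_pow_le_two {b : ℝ} (hb : 0 ≤ b) {m : ℕ} (hmb : (m : ℝ) * b ≤ 1 / 2) : (1 + b) ^ m ≤ 2 := by
  have h1 : (1 + b) ^ m ≤ Real.exp b ^ m :=
    pow_le_pow_left₀ (by linarith) (by linarith [Real.add_one_le_exp b]) m
  have h2 : Real.exp b ^ m = Real.exp ((m : ℝ) * b) := by rw [← Real.exp_nat_mul]
  have h3 : Real.exp ((m : ℝ) * b) ≤ Real.exp (1 / 2) := Real.exp_le_exp.2 hmb
  have h4 : Real.exp (1 / 2) ≤ 2 := by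
    have he : Real.exp (1 / 2) ^ 2 = Real.exp 1 := by rw [← Real.exp_nat_mul]; norm_num
    have h9 := Real.exp_one_lt_d9
    nlinarith [Real.exp_pos (1 / 2 : ℝ)]
  linarith

variable [NormedAlgebra ℂ 𝔸]

/-- The mean of a family bounded by `B` in norm has norm `≤ B`. [folklore] -/
private theorem norm_mean_le {ι : Type*} [Fintype ι] [Nonempty ι] {m : ι → 𝔸} {B : ℝ} (h : ∀ i, ‖m i‖ ≤ B) :
    ‖((Fintype.card ι : ℂ))⁻¹ • ∑ i, m i‖ ≤ B := by
  have hc : (0 : ℝ) < Fintype.card ι := Nat.cast_pos.mpr Fintype.card_pos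
  have hsum : ∑ i, ‖m i‖ ≤ ∑ _i : ι, B := Finset.sum_le_sum fun i _ => h i
  rw [Finset.sum_const, Finset.card_univ, nsmul_eq_mul] at hsum
  rw [norm_smul, norm_inv, Complex.norm_natCast, inv_mul_le_iff₀ hc]
  exact (norm_sum_le _ _).trans hsum

/-- The mean of a constant family is the constant. [folklore] -/
private theorem mean_const {ι : Type*} [Fintype ι] [Nonempty ι] (X : 𝔸) :
    ((Fintype.card ι : ℂ))⁻¹ • ∑ _i : ι, X = X := by
  have hc : (Fintype.card ι : ℂ) ≠ 0 := Nat.cast_ne_zero.mpr Fintype.card_pos.ne'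
  rw [Finset.sum_const, Finset.card_univ, ← Nat.cast_smul_eq_nsmul ℂ, smul_smul, inv_mul_cancel₀ hc, one_smul]

end Algebra

/-! ## §2 Signed sums of a bond field along lattice walks (the linear holonomy) -/

section Walks

open T4Continuum BlockAveraging

variable {P : Params} {j : ℕ} {V : Type*} [AddCommGroup V]

/-- **THE SIGNED SUM `Y(Γ) = Σ_{b⊂Γ} ±Y_b` OF A BOND FIELD ALONG A SEQUENCE OF ORIENTED STEPS** (`+` on forward steps, `−` on backward ones):
the linear (Lie-algebra) shadow of the parallel transport `T4Continuum.holAt` («`A(Γ) = Σ_{b⊂Γ} A_b` for arbitrary contour `Γ`»).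
[cite: Balaban1984PropagatorsI, (1.8) p.19] -/
def walkSum (Y : PBond P j → V) (γ : List (LStep P j)) : V :=
  (γ.map fun s => if s.fwd then Y s.bond else -Y s.bond).sum

/-- No steps, zero sum. [cite: Balaban1984PropagatorsI, (1.8) p.19 (bookkeeping)] -/
@[simp] theorem walkSum_nil (Y : PBond P j → V) : walkSum Y [] = 0 := by
  simp [walkSum]

/-- One step more: `Y(s·Γ) = ±Y_{b(s)} + Y(Γ)`. [cite: Balaban1984PropagatorsI, (1.8) p.19 (bookkeeping)] -/
theorem walkSum_cons (Y : PBond P j → V) (s : LStep P j) (γ : List (LStep P j)) :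
    walkSum Y (s :: γ) = (if s.fwd then Y s.bond else -Y s.bond) + walkSum Y γ := by
  simp [walkSum]

/-- Additivity under concatenation: `Y(Γ₁ ∪ Γ₂) = Y(Γ₁) + Y(Γ₂)`. [cite: Balaban1984PropagatorsI, (1.8) p.19 (bookkeeping)] -/
theorem walkSum_append (Y : PBond P j → V) (γ₁ γ₂ : List (LStep P j)) :
    walkSum Y (γ₁ ++ γ₂) = walkSum Y γ₁ + walkSum Y γ₂ := by
  simp [walkSum, List.map_append, List.sum_append]

omit [AddCommGroup V] in
/-- A walk has as many steps as its word has letters. [cite: Balaban1987RG1, (0.3) p.252 (bookkeeping)] -/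
theorem length_walk : ∀ (x : Site P j) (w : List (Letter P.d)), (walk x w).length = w.length
  | _, [] => rfl
  | x, (μ, true) :: w => by simp only [walk, List.length_cons, length_walk (x.shift μ) w]
  | x, (μ, false) :: w => by simp only [walk, List.length_cons, length_walk (x.unshift μ) w]

end Walks

/-! ## §3 `SU(N)` holonomies to first order in the bond variables `Y_b = U_b − 1` -/

section Hol

open T4Continuum BlockAveraging
open scoped Matrix.Norms.L2Operator

variable {n : Type*} [Fintype n] [DecidableEq n] {P : Params} {j : ℕ}

/-- Elements of `SU(N)` are unitary matrices. [folklore] -/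
private theorem coe_mem_unitaryGroup (g : Matrix.specialUnitaryGroup n ℂ) : (g : Matrix n n ℂ) ∈ Matrix.unitaryGroup n ℂ :=
  (Matrix.mem_specialUnitaryGroup_iff.1 g.2).1

/-- `g* · g = 1` for `g ∈ SU(N)`. [folklore] -/
private theorem coe_star_mul_self (g : Matrix.specialUnitaryGroup n ℂ) : star (g : Matrix n n ℂ) * (g : Matrix n n ℂ) = 1 :=
  Unitary.star_mul_self_of_mem (coe_mem_unitaryGroup g)

/-- The inverse in `SU(N)` is the conjugate transpose (coercion lemma). [folklore] -/
private theorem coe_inv_eq_star (g : Matrix.specialUnitaryGroup n ℂ) :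
    ((g⁻¹ : Matrix.specialUnitaryGroup n ℂ) : Matrix n n ℂ) = star (g : Matrix n n ℂ) := rfl

variable [Nonempty n]

/-- The matrix of a holonomy is the ordered product of the matrices `U_b` ∕ `U_b*` of its steps (parallel transport along a contour). [cite: Balaban1985Averaging, (9) p.19 (bookkeeping)] -/
theorem coe_holAt_eq_prod (U : GaugeField P j (Matrix.specialUnitaryGroup n ℂ)) :
    ∀ γ : List (LStep P j), ((holAt U γ : Matrix.specialUnitaryGroup n ℂ) : Matrix n n ℂ) =
      (γ.map fun s => if s.fwd then ((U s.bond : Matrix.specialUnitaryGroup n ℂ) : Matrix n n ℂ)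
        else star ((U s.bond : Matrix.specialUnitaryGroup n ℂ) : Matrix n n ℂ)).prod
  | [] => by simp [holAt]
  | s :: γ => by
    rw [holAt_cons, List.map_cons, List.prod_cons, Submonoid.coe_mul, coe_holAt_eq_prod U γ]
    cases s.fwd <;> simp [coe_inv_eq_star]

/-- The step factors of a holonomy, read in `M_N(ℂ)`: `U_b` on a forward step, `U_b* = U_b⁻¹` on a backward one. [folklore] -/
def stepFactor (U : GaugeField P j (Matrix.specialUnitaryGroup n ℂ)) (s : LStep P j) : Matrix n n ℂ :=
  if s.fwd then ((U s.bond : Matrix.specialUnitaryGroup n ℂ) : Matrix n n ℂ) else star ((U s.bond : Matrix.specialUnitaryGroup n ℂ) : Matrix n n ℂ)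

/-- `coe_holAt_eq_prod` in terms of `stepFactor`. [cite: Balaban1985Averaging, (9) p.19 (bookkeeping)] -/
theorem coe_holAt_eq_prod_stepFactor (U : GaugeField P j (Matrix.specialUnitaryGroup n ℂ)) (γ : List (LStep P j)) :
    ((holAt U γ : Matrix.specialUnitaryGroup n ℂ) : Matrix n n ℂ) = (γ.map (stepFactor U)).prod :=
  coe_holAt_eq_prod U γ

/-- `‖g‖ = 1` (operator norm) for `g ∈ SU(N)`. [folklore] -/
private theorem norm_coe_eq_one (g : Matrix.specialUnitaryGroup n ℂ) : ‖(g : Matrix n n ℂ)‖ = 1 :=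
  CStarRing.norm_of_mem_unitary (coe_mem_unitaryGroup g)

/-- `‖g*‖ = 1` for `g ∈ SU(N)`. [folklore] -/
private theorem norm_star_coe_eq_one (g : Matrix.specialUnitaryGroup n ℂ) : ‖star (g : Matrix n n ℂ)‖ = 1 := by
  rw [← coe_inv_eq_star, norm_coe_eq_one]

/-- **THE INVERSE TO SECOND ORDER**: `‖U⁻¹ − 1 + (U − 1)‖ ≤ ‖U − 1‖²` for `U ∈ SU(N)` (`U⁻¹ − 1 + (U − 1) = U⁻¹(U − 1)²`). [folklore] -/
private theorem norm_star_sub_one_add_le (g : Matrix.specialUnitaryGroup n ℂ) :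
    ‖star (g : Matrix n n ℂ) - 1 + ((g : Matrix n n ℂ) - 1)‖ ≤ ‖(g : Matrix n n ℂ) - 1‖ ^ 2 := by
  have e : star (g : Matrix n n ℂ) - 1 + ((g : Matrix n n ℂ) - 1) =
      star (g : Matrix n n ℂ) * (((g : Matrix n n ℂ) - 1) * ((g : Matrix n n ℂ) - 1)) := by
    have h := coe_star_mul_self g
    have e1 : star (g : Matrix n n ℂ) * (((g : Matrix n n ℂ) - 1) * ((g : Matrix n n ℂ) - 1)) =
        star (g : Matrix n n ℂ) * (g : Matrix n n ℂ) * (g : Matrix n n ℂ) - star (g : Matrix n n ℂ) * (g : Matrix n n ℂ) -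
          star (g : Matrix n n ℂ) * (g : Matrix n n ℂ) + star (g : Matrix n n ℂ) := by noncomm_ring
    rw [e1, h]; noncomm_ring
  rw [e]
  calc ‖star (g : Matrix n n ℂ) * (((g : Matrix n n ℂ) - 1) * ((g : Matrix n n ℂ) - 1))‖
      ≤ ‖star (g : Matrix n n ℂ)‖ * (‖(g : Matrix n n ℂ) - 1‖ * ‖(g : Matrix n n ℂ) - 1‖) :=
        (norm_mul_le _ _).trans (mul_le_mul_of_nonneg_left (norm_mul_le _ _) (norm_nonneg _))
    _ = ‖(g : Matrix n n ℂ) - 1‖ ^ 2 := by rw [norm_star_coe_eq_one, one_mul, sq]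

/-- The step factors are within `δ` of `1` when the bond variables are. [folklore] -/
private theorem norm_stepFactor_sub_one_le (U : GaugeField P j (Matrix.specialUnitaryGroup n ℂ)) {δ : ℝ}
    (hU : ∀ b, ‖((U b : Matrix.specialUnitaryGroup n ℂ) : Matrix n n ℂ) - 1‖ ≤ δ) (s : LStep P j) :
    ‖stepFactor U s - 1‖ ≤ δ := by
  unfold stepFactor
  cases s.fwd
  · simp only [Bool.false_eq_true, ↓reduceIte]
    rw [← coe_inv_eq_star, ← FederbushMean.dist1_SU_eq, GaugeGroup.dist1_inv, FederbushMean.dist1_SU_eq]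
    exact hU s.bond
  · simpa using hU s.bond

/-- A step factor minus `1` is the SIGNED bond variable to second order: `0` on a forward step, `‖U_b⁻¹ − 1 + Y_b‖ ≤ δ²` on a backward one. [folklore] -/
private theorem norm_stepFactor_sub_one_sub_signed_le (U : GaugeField P j (Matrix.specialUnitaryGroup n ℂ)) {δ : ℝ}
    (hU : ∀ b, ‖((U b : Matrix.specialUnitaryGroup n ℂ) : Matrix n n ℂ) - 1‖ ≤ δ) (s : LStep P j) :
    ‖(stepFactor U s - 1) - (if s.fwd then ((U s.bond : Matrix.specialUnitaryGroup n ℂ) : Matrix n n ℂ) - 1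
        else -(((U s.bond : Matrix.specialUnitaryGroup n ℂ) : Matrix n n ℂ) - 1))‖ ≤ δ ^ 2 := by
  unfold stepFactor
  cases s.fwd
  · simp only [Bool.false_eq_true, ↓reduceIte, sub_neg_eq_add]
    exact (norm_star_sub_one_add_le (U s.bond)).trans (pow_le_pow_left₀ (norm_nonneg _) (hU s.bond) 2)
  · simp only [↓reduceIte, sub_self, norm_zero]
    positivity

/-- The sum of the `(stepFactor − 1)` along a sequence of steps is the signed sum `walkSum` of the bond variables to second order:
`‖Σ_s (f_s − 1) − Y(Γ)‖ ≤ |Γ|·δ²`. [folklore] -/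
private theorem norm_sum_stepFactor_sub_walkSum_le (U : GaugeField P j (Matrix.specialUnitaryGroup n ℂ)) {δ : ℝ}
    (hU : ∀ b, ‖((U b : Matrix.specialUnitaryGroup n ℂ) : Matrix n n ℂ) - 1‖ ≤ δ) :
    ∀ γ : List (LStep P j), ‖((γ.map (stepFactor U)).map (· - 1)).sum -
        walkSum (fun b => ((U b : Matrix.specialUnitaryGroup n ℂ) : Matrix n n ℂ) - 1) γ‖ ≤ γ.length * δ ^ 2
  | [] => by simp [walkSum]
  | s :: γ => by
    have ih := norm_sum_stepFactor_sub_walkSum_le U hU γ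
    have hs := norm_stepFactor_sub_one_sub_signed_le U hU s
    rw [List.map_cons, List.map_cons, List.sum_cons, walkSum_cons, List.length_cons]
    have e : (stepFactor U s - 1) + ((γ.map (stepFactor U)).map (· - 1)).sum -
        ((if s.fwd then ((U s.bond : Matrix.specialUnitaryGroup n ℂ) : Matrix n n ℂ) - 1
          else -(((U s.bond : Matrix.specialUnitaryGroup n ℂ) : Matrix n n ℂ) - 1)) +
          walkSum (fun b => ((U b : Matrix.specialUnitaryGroup n ℂ) : Matrix n n ℂ) - 1) γ) =
        ((stepFactor U s - 1) - (if s.fwd then ((U s.bond : Matrix.specialUnitaryGroup n ℂ) : Matrix n n ℂ) - 1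
          else -(((U s.bond : Matrix.specialUnitaryGroup n ℂ) : Matrix n n ℂ) - 1))) +
        (((γ.map (stepFactor U)).map (· - 1)).sum -
          walkSum (fun b => ((U b : Matrix.specialUnitaryGroup n ℂ) : Matrix n n ℂ) - 1) γ) := by abel
    rw [e]
    calc _ ≤ δ ^ 2 + γ.length * δ ^ 2 := (norm_add_le _ _).trans (add_le_add hs ih)
      _ = ((γ.length + 1 : ℕ) : ℝ) * δ ^ 2 := by push_cast; ring

/-- **ZEROTH ORDER**: `‖U(Γ) − 1‖ ≤ (1+δ)^{|Γ|} − 1` along any sequence of steps when `‖U_b − 1‖ ≤ δ` for every bond (the size of a contour variable from the sizes of its bond variables). [cite: Balaban1985Averaging, (122)-(123) p.36] -/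
theorem norm_holAt_sub_one_le (U : GaugeField P j (Matrix.specialUnitaryGroup n ℂ)) {δ : ℝ} (hδ : 0 ≤ δ)
    (hU : ∀ b, ‖((U b : Matrix.specialUnitaryGroup n ℂ) : Matrix n n ℂ) - 1‖ ≤ δ) (γ : List (LStep P j)) :
    ‖((holAt U γ : Matrix.specialUnitaryGroup n ℂ) : Matrix n n ℂ) - 1‖ ≤ (1 + δ) ^ γ.length - 1 := by
  rw [coe_holAt_eq_prod_stepFactor]
  have h := norm_prod_sub_one_le δ hδ (γ.map (stepFactor U))
    (by
      intro x hx
      obtain ⟨s, -, rfl⟩ := List.mem_map.1 hx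
      exact norm_stepFactor_sub_one_le U hU s)
  rwa [List.length_map] at h

/-- **FIRST ORDER**: `‖U(Γ) − 1 − Y(Γ)‖ ≤ (1+δ)^m − 1 − m·δ + m·δ²` (`m = |Γ|`, `Y_b = U_b − 1`, `Y(Γ)` = `walkSum`): the product of the step factors
is the sum of the `(factor − 1)` to second order, and a backward factor `U_b⁻¹ − 1` is `−Y_b` to second order. [cite: Balaban1985Averaging, (122)-(123) p.36] -/
theorem norm_holAt_sub_one_sub_walkSum_le (U : GaugeField P j (Matrix.specialUnitaryGroup n ℂ)) {δ : ℝ} (hδ : 0 ≤ δ)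
    (hU : ∀ b, ‖((U b : Matrix.specialUnitaryGroup n ℂ) : Matrix n n ℂ) - 1‖ ≤ δ) (γ : List (LStep P j)) :
    ‖((holAt U γ : Matrix.specialUnitaryGroup n ℂ) : Matrix n n ℂ) - 1 -
        walkSum (fun b => ((U b : Matrix.specialUnitaryGroup n ℂ) : Matrix n n ℂ) - 1) γ‖ ≤
      (1 + δ) ^ γ.length - 1 - γ.length * δ + γ.length * δ ^ 2 := by
  have hprod := norm_prod_sub_one_sub_sum_le δ hδ (γ.map (stepFactor U))
    (by
      intro x hx
      obtain ⟨s, -, rfl⟩ := List.mem_map.1 hx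
      exact norm_stepFactor_sub_one_le U hU s)
  rw [List.length_map] at hprod
  have hback := norm_sum_stepFactor_sub_walkSum_le U hU γ
  rw [coe_holAt_eq_prod_stepFactor]
  have e : (γ.map (stepFactor U)).prod - 1 - walkSum (fun b => ((U b : Matrix.specialUnitaryGroup n ℂ) : Matrix n n ℂ) - 1) γ =
      ((γ.map (stepFactor U)).prod - 1 - ((γ.map (stepFactor U)).map (· - 1)).sum) +
      (((γ.map (stepFactor U)).map (· - 1)).sum - walkSum (fun b => ((U b : Matrix.specialUnitaryGroup n ℂ) : Matrix n n ℂ) - 1) γ) := by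
    abel
  rw [e]
  exact (norm_add_le _ _).trans (add_le_add hprod hback)

end Hol

/-! ## §4 The linearised (0.4) average at the flat background and the second-order estimate -/

section Main

open T4Continuum BlockAveraging AveragingRT ExpMeanLog LatticeWordStokes
open scoped Matrix.Norms.L2Operator

variable {𝔸 : Type*} [NormedRing 𝔸]

/-- Four near-`1` factors to second order: `‖abcd − 1 − Σ(· − 1)‖ ≤ 7t²` when every factor is within `t ≤ ⅛` of `1`. [folklore] -/
private theorem norm_prod_four_sub_le {a b c d : 𝔸} {t : ℝ} (ht0 : 0 ≤ t) (ht : t ≤ 1 / 8) (ha : ‖a - 1‖ ≤ t) (hb : ‖b - 1‖ ≤ t)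
    (hc : ‖c - 1‖ ≤ t) (hd : ‖d - 1‖ ≤ t) :
    ‖a * b * c * d - 1 - ((a - 1) + (b - 1) + (c - 1) + (d - 1))‖ ≤ 7 * t ^ 2 := by
  have h := norm_prod_sub_one_sub_sum_le t ht0 [a, b, c, d] (by
    intro x hx
    simp only [List.mem_cons, List.not_mem_nil, or_false] at hx
    rcases hx with rfl | rfl | rfl | rfl <;> assumption)
  simp only [List.prod_cons, List.prod_nil, mul_one, List.map_cons, List.map_nil, List.sum_cons, List.sum_nil, add_zero,
    List.length_cons, List.length_nil] at h
  have e : a * (b * (c * d)) - 1 - ((a - 1) + ((b - 1) + ((c - 1) + (d - 1)))) =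
      a * b * c * d - 1 - ((a - 1) + (b - 1) + (c - 1) + (d - 1)) := by noncomm_ring
  rw [e] at h
  refine h.trans ?_
  push_cast
  nlinarith [sq_nonneg t, mul_nonneg ht0 ht0, pow_nonneg ht0 3, pow_nonneg ht0 4]

variable {n : Type*} [Fintype n] [DecidableEq n] [Nonempty n] {P : Params} {j : ℕ}

/-- A segment of at most `m` steps, `mδ ≤ ½`: `‖U(Γ) − 1‖ ≤ 2mδ`. [cite: Balaban1985Averaging, (122)-(123) p.36] -/
theorem norm_holAt_sub_one_le_of_length_le (U : GaugeField P j (Matrix.specialUnitaryGroup n ℂ)) {δ : ℝ} (hδ : 0 ≤ δ)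
    (hU : ∀ b, ‖((U b : Matrix.specialUnitaryGroup n ℂ) : Matrix n n ℂ) - 1‖ ≤ δ) {m : ℕ} (hm : (m : ℝ) * δ ≤ 1 / 2)
    (γ : List (LStep P j)) (hγ : γ.length ≤ m) :
    ‖((holAt U γ : Matrix.specialUnitaryGroup n ℂ) : Matrix n n ℂ) - 1‖ ≤ 2 * m * δ := by
  have hlen : (γ.length : ℝ) ≤ m := by exact_mod_cast hγ
  have hγδ : (γ.length : ℝ) * δ ≤ 1 / 2 := (mul_le_mul_of_nonneg_right hlen hδ).trans hm
  have h2 : (1 + δ) ^ γ.length ≤ 2 := one_add_pow_le_two hδ hγδ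
  have h1 := one_add_pow_sub_one_le δ hδ γ.length
  have h0 : 0 ≤ (γ.length : ℝ) * δ := mul_nonneg (Nat.cast_nonneg _) hδ
  calc ‖((holAt U γ : Matrix.specialUnitaryGroup n ℂ) : Matrix n n ℂ) - 1‖ ≤ (1 + δ) ^ γ.length - 1 := norm_holAt_sub_one_le U hδ hU γ
    _ ≤ γ.length * δ * (1 + δ) ^ γ.length := h1
    _ ≤ γ.length * δ * 2 := mul_le_mul_of_nonneg_left h2 h0
    _ ≤ 2 * m * δ := by nlinarith

/-- A segment of at most `m` steps, `mδ ≤ ½`: `‖U(Γ) − 1 − Y(Γ)‖ ≤ 3m²δ²`. [cite: Balaban1985Averaging, (123) p.36] -/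
theorem norm_holAt_sub_one_sub_walkSum_le_of_length_le (U : GaugeField P j (Matrix.specialUnitaryGroup n ℂ)) {δ : ℝ} (hδ : 0 ≤ δ)
    (hU : ∀ b, ‖((U b : Matrix.specialUnitaryGroup n ℂ) : Matrix n n ℂ) - 1‖ ≤ δ) {m : ℕ} (hm : (m : ℝ) * δ ≤ 1 / 2)
    (γ : List (LStep P j)) (hγ : γ.length ≤ m) :
    ‖((holAt U γ : Matrix.specialUnitaryGroup n ℂ) : Matrix n n ℂ) - 1 -
        walkSum (fun b => ((U b : Matrix.specialUnitaryGroup n ℂ) : Matrix n n ℂ) - 1) γ‖ ≤ 3 * (m : ℝ) ^ 2 * δ ^ 2 := by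
  have hlen : (γ.length : ℝ) ≤ m := by exact_mod_cast hγ
  have hγδ : (γ.length : ℝ) * δ ≤ 1 / 2 := (mul_le_mul_of_nonneg_right hlen hδ).trans hm
  have h2 : (1 + δ) ^ γ.length ≤ 2 := one_add_pow_le_two hδ hγδ
  have h1 := one_add_pow_sub_one_sub_mul_le δ hδ γ.length
  have hmm : (m : ℝ) ≤ (m : ℝ) ^ 2 := by
    rcases Nat.eq_zero_or_pos m with h | h
    · simp [h]
    · have : (1 : ℝ) ≤ m := by exact_mod_cast h
      nlinarith
  have hl0 : (0 : ℝ) ≤ γ.length := Nat.cast_nonneg _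
  calc _ ≤ (1 + δ) ^ γ.length - 1 - γ.length * δ + γ.length * δ ^ 2 := norm_holAt_sub_one_sub_walkSum_le U hδ hU γ
    _ ≤ (γ.length : ℝ) ^ 2 * δ ^ 2 * (1 + δ) ^ γ.length + γ.length * δ ^ 2 := by linarith
    _ ≤ (γ.length : ℝ) ^ 2 * δ ^ 2 * 2 + γ.length * δ ^ 2 :=
        add_le_add (mul_le_mul_of_nonneg_left h2 (by positivity)) le_rfl
    _ ≤ (m : ℝ) ^ 2 * δ ^ 2 * 2 + m * δ ^ 2 := by gcongr
    _ ≤ 3 * (m : ℝ) ^ 2 * δ ^ 2 := by nlinarith [mul_le_mul_of_nonneg_right hmm (sq_nonneg δ)]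

/-- **THE LINEARISED (0.4) AVERAGE AT THE FLAT BACKGROUND** `(Q₁Y)(c) = |I|⁻¹ Σ_{(n,σ,σ′)} [Y(Γ^σ_{y→x}) + Y([x, x′]) − Y(Γ^{σ′}_{y′→x′})]`
(`c = ⟨y, y + e_μ⟩`, `x = y + n ∈ B(y)`, `x′ = x + Le_μ`, `y′ = y + e_μ`): the first-order term of `Ū(c) − 1` in the bond variables `Y_b = U_b − 1`
(= (125) `L·Q(R₀Y)` read through the ordering-symmetrised block-axial representative `R₀Y` of (0.3), see the module docstring).
[cite: Balaban1985Averaging, (124)-(125) p.36] -/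
def linAvg (Y : PBond P j → Matrix n n ℂ) (c : PBond P (j + 1)) : Matrix n n ℂ :=
  ((Fintype.card (Idx P) : ℂ))⁻¹ • ∑ i : Idx P,
    (walkSum Y (walk (emb c.src) (stairWord i.2.1 (off i.1))) +
      walkSum Y (walk (walkEnd (emb c.src) (stairWord i.2.1 (off i.1))) (List.replicate P.L (c.dir, true))) -
      walkSum Y (walk (emb c.tgt) (stairWord i.2.2 (off i.1))))

omit [Fintype n] [DecidableEq n] [Nonempty n] in
/-- `linAvg` unfolded. [cite: Balaban1985Averaging, (124)-(125) p.36] -/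
theorem linAvg_def (Y : PBond P j → Matrix n n ℂ) (c : PBond P (j + 1)) :
    linAvg Y c = ((Fintype.card (Idx P) : ℂ))⁻¹ • ∑ i : Idx P,
      (walkSum Y (walk (emb c.src) (stairWord i.2.1 (off i.1))) +
        walkSum Y (walk (walkEnd (emb c.src) (stairWord i.2.1 (off i.1))) (List.replicate P.L (c.dir, true))) -
        walkSum Y (walk (emb c.tgt) (stairWord i.2.2 (off i.1)))) := rfl

/-- A staircase of (0.3) has at most `d·⌊(L−1)/2⌋ ≤ (d+2)L` steps. [cite: Balaban1987RG1, (0.3) p.252] -/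
theorem length_walk_stairWord_le (x : Site P j) (σ : Equiv.Perm (Fin P.d)) (r : Fin P.d → Fin P.L) :
    (walk x (stairWord σ (off r))).length ≤ (P.d + 2) * P.L := by
  rw [length_walk]
  have hN : ∀ ν, (off r ν).natAbs ≤ (P.L - 1) / 2 := by
    intro ν
    have h := off_bounds r ν
    omega
  refine (length_stairWord_le σ (off r) _ hN).trans ?_
  have h1 : (P.L - 1) / 2 ≤ P.L := by omega
  calc P.d * ((P.L - 1) / 2) ≤ P.d * P.L := Nat.mul_le_mul_left _ h1
    _ ≤ (P.d + 2) * P.L := Nat.mul_le_mul_right _ (by omega)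

omit [Nonempty n] in
/-- A straight segment of (0.4) has `L ≤ (d+2)L` steps. [cite: Balaban1987RG1, (0.4) p.253] -/
theorem length_walk_replicate_le (x : Site P j) (μ : Fin P.d) (b : Bool) :
    (walk x (List.replicate P.L (μ, b))).length ≤ (P.d + 2) * P.L := by
  rw [length_walk, List.length_replicate]
  exact Nat.le_mul_of_pos_left _ (by omega)

/-- **PER LOOP INDEX, THE (0.4) LOOP VARIABLE TO FIRST ORDER**: with `A, B, C` the holonomies of the three segments `Γ^σ_{y→x}`, `[x, x′]`,
`Γ^{σ′}_{y′→x′}` and `S = U(c)`, `W_i = A·B·C⁻¹·S⁻¹` and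
`‖(W_i − 1) − (Y(Γ^σ) + Y([x,x′]) − Y(Γ^{σ′}) − (S − 1))‖ ≤ 49·(ℓδ)²` (`ℓ = (d+2)L`, `16ℓδ ≤ 1`). [cite: Balaban1985Averaging, (122)-(123) p.36] -/
theorem loop_first_order_le (U : GaugeField P j (Matrix.specialUnitaryGroup n ℂ)) {δ : ℝ} (hδ : 0 ≤ δ)
    (hU : ∀ b, ‖((U b : Matrix.specialUnitaryGroup n ℂ) : Matrix n n ℂ) - 1‖ ≤ δ)
    (h16 : 16 * ((((P.d + 2) * P.L : ℕ) : ℝ) * δ) ≤ 1) (c : PBond P (j + 1)) (i : Idx P) :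
    ‖(((loopHol U c i : Matrix.specialUnitaryGroup n ℂ) : Matrix n n ℂ) - 1) -
        (walkSum (fun b => ((U b : Matrix.specialUnitaryGroup n ℂ) : Matrix n n ℂ) - 1) (walk (emb c.src) (stairWord i.2.1 (off i.1))) +
          walkSum (fun b => ((U b : Matrix.specialUnitaryGroup n ℂ) : Matrix n n ℂ) - 1)
            (walk (walkEnd (emb c.src) (stairWord i.2.1 (off i.1))) (List.replicate P.L (c.dir, true))) -
          walkSum (fun b => ((U b : Matrix.specialUnitaryGroup n ℂ) : Matrix n n ℂ) - 1) (walk (emb c.tgt) (stairWord i.2.2 (off i.1))) -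
          (((axialAvg U c : Matrix.specialUnitaryGroup n ℂ) : Matrix n n ℂ) - 1))‖ ≤
      49 * ((((P.d + 2) * P.L : ℕ) : ℝ) * δ) ^ 2 := by
  -- letters
  set ℓ : ℝ := (((P.d + 2) * P.L : ℕ) : ℝ) with hℓ
  set θ : ℝ := 2 * ℓ * δ with hθ
  have hℓ0 : 0 ≤ ℓ := Nat.cast_nonneg _
  have hℓδ : ℓ * δ ≤ 1 / 2 := by nlinarith [mul_nonneg hℓ0 hδ]
  have hθ0 : 0 ≤ θ := by positivity
  have hθ8 : θ ≤ 1 / 8 := by rw [hθ]; nlinarith [mul_nonneg hℓ0 hδ]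
  set Y : PBond P j → Matrix n n ℂ := fun b => ((U b : Matrix.specialUnitaryGroup n ℂ) : Matrix n n ℂ) - 1 with hY
  -- the four segments
  set γA := walk (emb c.src) (stairWord i.2.1 (off i.1)) with hγA
  set γB := walk (walkEnd (emb c.src) (stairWord i.2.1 (off i.1))) (List.replicate P.L (c.dir, true)) with hγB
  set γC := walk (emb c.tgt) (stairWord i.2.2 (off i.1)) with hγC
  have hA_len : γA.length ≤ (P.d + 2) * P.L := length_walk_stairWord_le _ _ _
  have hB_len : γB.length ≤ (P.d + 2) * P.L := length_walk_replicate_le _ _ _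
  have hC_len : γC.length ≤ (P.d + 2) * P.L := length_walk_stairWord_le _ _ _
  have hS : axialAvg U c = holAt U (walk (emb c.src) (List.replicate P.L (c.dir, true))) := axialAvg_eq_holAt_walk U c
  have hS_len : (walk (emb c.src) (List.replicate P.L (c.dir, true))).length ≤ (P.d + 2) * P.L := length_walk_replicate_le _ _ _
  set A : Matrix n n ℂ := ((holAt U γA : Matrix.specialUnitaryGroup n ℂ) : Matrix n n ℂ) with hA
  set B : Matrix n n ℂ := ((holAt U γB : Matrix.specialUnitaryGroup n ℂ) : Matrix n n ℂ) with hB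
  set C : Matrix n n ℂ := ((holAt U γC : Matrix.specialUnitaryGroup n ℂ) : Matrix n n ℂ) with hC
  set S : Matrix n n ℂ := ((axialAvg U c : Matrix.specialUnitaryGroup n ℂ) : Matrix n n ℂ) with hSdef
  -- zeroth order: every segment within `θ` of `1`
  have hA1 : ‖A - 1‖ ≤ θ := norm_holAt_sub_one_le_of_length_le U hδ hU hℓδ γA hA_len
  have hB1 : ‖B - 1‖ ≤ θ := norm_holAt_sub_one_le_of_length_le U hδ hU hℓδ γB hB_len
  have hC1 : ‖C - 1‖ ≤ θ := norm_holAt_sub_one_le_of_length_le U hδ hU hℓδ γC hC_len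
  have hS1 : ‖S - 1‖ ≤ θ := by
    rw [hSdef, hS]; exact norm_holAt_sub_one_le_of_length_le U hδ hU hℓδ _ hS_len
  have hCs1 : ‖star C - 1‖ ≤ θ := by
    rw [hC, ← coe_inv_eq_star, ← FederbushMean.dist1_SU_eq, GaugeGroup.dist1_inv, FederbushMean.dist1_SU_eq]; exact hC1
  have hSs1 : ‖star S - 1‖ ≤ θ := by
    rw [hSdef, ← coe_inv_eq_star, ← FederbushMean.dist1_SU_eq, GaugeGroup.dist1_inv, FederbushMean.dist1_SU_eq]; exact hS1
  -- first order: every segment is its signed sum to second order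
  have hA2 : ‖A - 1 - walkSum Y γA‖ ≤ 3 * ℓ ^ 2 * δ ^ 2 := norm_holAt_sub_one_sub_walkSum_le_of_length_le U hδ hU hℓδ γA hA_len
  have hB2 : ‖B - 1 - walkSum Y γB‖ ≤ 3 * ℓ ^ 2 * δ ^ 2 := norm_holAt_sub_one_sub_walkSum_le_of_length_le U hδ hU hℓδ γB hB_len
  have hC2 : ‖C - 1 - walkSum Y γC‖ ≤ 3 * ℓ ^ 2 * δ ^ 2 := norm_holAt_sub_one_sub_walkSum_le_of_length_le U hδ hU hℓδ γC hC_len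
  -- the inverses to second order
  have hC3 : ‖star C - 1 + (C - 1)‖ ≤ θ ^ 2 :=
    (norm_star_sub_one_add_le _).trans (pow_le_pow_left₀ (norm_nonneg _) hC1 2)
  have hS3 : ‖star S - 1 + (S - 1)‖ ≤ θ ^ 2 :=
    (norm_star_sub_one_add_le _).trans (pow_le_pow_left₀ (norm_nonneg _) hS1 2)
  -- the loop variable is the product of the four
  have hW : ((loopHol U c i : Matrix.specialUnitaryGroup n ℂ) : Matrix n n ℂ) = A * B * star C * star S := by
    rw [BlockAveragingEMLProp2.loopHol_eq U c i, Submonoid.coe_mul, Submonoid.coe_mul, Submonoid.coe_mul, coe_inv_eq_star, coe_inv_eq_star]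
  have h4 := norm_prod_four_sub_le hθ0 hθ8 hA1 hB1 hCs1 hSs1
  -- assemble
  have e : (((loopHol U c i : Matrix.specialUnitaryGroup n ℂ) : Matrix n n ℂ) - 1) -
      (walkSum Y γA + walkSum Y γB - walkSum Y γC - (S - 1)) =
      (A * B * star C * star S - 1 - ((A - 1) + (B - 1) + (star C - 1) + (star S - 1))) +
      (star C - 1 + (C - 1)) + (star S - 1 + (S - 1)) + (A - 1 - walkSum Y γA) + (B - 1 - walkSum Y γB) - (C - 1 - walkSum Y γC) := by
    rw [hW]; abel
  rw [e]
  have hθ2 : θ ^ 2 = 4 * (ℓ * δ) ^ 2 := by rw [hθ]; ring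
  calc _ ≤ ‖A * B * star C * star S - 1 - ((A - 1) + (B - 1) + (star C - 1) + (star S - 1))‖ +
        ‖star C - 1 + (C - 1)‖ + ‖star S - 1 + (S - 1)‖ + ‖A - 1 - walkSum Y γA‖ + ‖B - 1 - walkSum Y γB‖ +
        ‖C - 1 - walkSum Y γC‖ := by
          refine (norm_sub_le _ _).trans (add_le_add ?_ le_rfl)
          refine (norm_add_le _ _).trans (add_le_add ?_ le_rfl)
          refine (norm_add_le _ _).trans (add_le_add ?_ le_rfl)
          refine (norm_add_le _ _).trans (add_le_add ?_ le_rfl)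
          exact (norm_add_le _ _).trans (add_le_add le_rfl le_rfl)
    _ ≤ 7 * θ ^ 2 + θ ^ 2 + θ ^ 2 + 3 * ℓ ^ 2 * δ ^ 2 + 3 * ℓ ^ 2 * δ ^ 2 + 3 * ℓ ^ 2 * δ ^ 2 := by
          gcongr
    _ = 45 * (ℓ * δ) ^ 2 := by rw [hθ2]; ring
    _ ≤ 49 * (ℓ * δ) ^ 2 := by nlinarith [sq_nonneg (ℓ * δ)]

/-- **[Balaban1985Averaging] PROP. 3 (122)–(123) AT THE FLAT BACKGROUND FOR THE (0.4) AVERAGING OF RECORD** (`exp[mean log]` on `SU(N)`, any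
torus of `Setup`, any level): if every bond variable satisfies `‖U_b − 1‖ ≤ δ` with `16ℓδ ≤ 1` and `2ℓδ < δ_N` (`ℓ = (d+2)L`), then for every coarse
bond `c`, `‖Ū(c) − 1 − (Q₁Y)(c)‖ ≤ 81·(ℓδ)²` with `Ū = avgFun expMeanLogSU U`, `Y_b = U_b − 1`, `Q₁ = linAvg` — the averaged configuration is
LINEAR in the bond variables up to an explicit second-order remainder (print: `|C(V₀, A, c)| ≤ C₁L²|A|²`). [cite: Balaban1985Averaging, Prop. 3 (122)-(123) p.36] -/
theorem norm_avgFun_sub_one_sub_linAvg_le (U : GaugeField P j (Matrix.specialUnitaryGroup n ℂ)) {δ : ℝ} (hδ : 0 ≤ δ)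
    (hU : ∀ b, ‖((U b : Matrix.specialUnitaryGroup n ℂ) : Matrix n n ℂ) - 1‖ ≤ δ)
    (h16 : 16 * ((((P.d + 2) * P.L : ℕ) : ℝ) * δ) ≤ 1) (hN : 2 * ((((P.d + 2) * P.L : ℕ) : ℝ) * δ) < deltaSU n)
    (c : PBond P (j + 1)) :
    ‖((avgFun (expMeanLogSU (n := n)) U c : Matrix.specialUnitaryGroup n ℂ) : Matrix n n ℂ) - 1 -
        linAvg (fun b => ((U b : Matrix.specialUnitaryGroup n ℂ) : Matrix n n ℂ) - 1) c‖ ≤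
      81 * ((((P.d + 2) * P.L : ℕ) : ℝ) * δ) ^ 2 := by
  -- letters
  set ℓ : ℝ := (((P.d + 2) * P.L : ℕ) : ℝ) with hℓ
  set θ : ℝ := 2 * ℓ * δ with hθ
  have hℓ0 : 0 ≤ ℓ := Nat.cast_nonneg _
  have hℓδ : ℓ * δ ≤ 1 / 2 := by nlinarith [mul_nonneg hℓ0 hδ]
  have hθ0 : 0 ≤ θ := by positivity
  have hθ8 : θ ≤ 1 / 8 := by rw [hθ]; nlinarith [mul_nonneg hℓ0 hδ]
  have hθN : θ < deltaSU n := by rw [hθ, mul_assoc]; exact hN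
  set Y : PBond P j → Matrix n n ℂ := fun b => ((U b : Matrix.specialUnitaryGroup n ℂ) : Matrix n n ℂ) - 1 with hY
  -- every loop variable within `θ` of `1`
  have hloop : ∀ i, dist1 (loopHol U c i) ≤ θ := by
    intro i
    rw [FederbushMean.dist1_SU_eq]
    exact norm_holAt_sub_one_le_of_length_le U hδ hU hℓδ _ ((length_walk _ _).le.trans (length_loopWord_le c i))
  -- the correction factor to second order, and its size
  have hκ := BlockAveragingEMLProp2.norm_corr_sub_mean_le U c hloop hθN (hθ8.trans (by norm_num))
  have hκ1 : ‖((corr (expMeanLogSU (n := n)) U c : Matrix.specialUnitaryGroup n ℂ) : Matrix n n ℂ) - 1‖ ≤ 2 * θ := by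
    rw [← FederbushMean.dist1_SU_eq]
    exact BlockAveragingEMLProp2.dist1_corr_le_two_mul U c hloop hθN (hθ8.trans (by norm_num))
  -- the straight factor `S = U(c)`
  set S : Matrix n n ℂ := ((axialAvg U c : Matrix.specialUnitaryGroup n ℂ) : Matrix n n ℂ) with hSdef
  have hS1 : ‖S - 1‖ ≤ θ := by
    rw [hSdef, axialAvg_eq_holAt_walk U c]
    exact norm_holAt_sub_one_le_of_length_le U hδ hU hℓδ _ (length_walk_replicate_le _ _ _)
  -- per-index first-order errors
  set E : Idx P → Matrix n n ℂ := fun i =>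
    (((loopHol U c i : Matrix.specialUnitaryGroup n ℂ) : Matrix n n ℂ) - 1) -
      (walkSum Y (walk (emb c.src) (stairWord i.2.1 (off i.1))) +
        walkSum Y (walk (walkEnd (emb c.src) (stairWord i.2.1 (off i.1))) (List.replicate P.L (c.dir, true))) -
        walkSum Y (walk (emb c.tgt) (stairWord i.2.2 (off i.1))) - (S - 1)) with hE
  have hEi : ∀ i, ‖E i‖ ≤ 49 * (ℓ * δ) ^ 2 := fun i => loop_first_order_le U hδ hU h16 c i
  -- the mean of the loop variables, reorganised
  have hmean : ((Fintype.card (Idx P) : ℂ))⁻¹ • ∑ i, (((loopHol U c i : Matrix.specialUnitaryGroup n ℂ) : Matrix n n ℂ) - 1) =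
      linAvg Y c - (S - 1) + ((Fintype.card (Idx P) : ℂ))⁻¹ • ∑ i, E i := by
    have hsum : ∑ i, (((loopHol U c i : Matrix.specialUnitaryGroup n ℂ) : Matrix n n ℂ) - 1) =
        ∑ i : Idx P, (walkSum Y (walk (emb c.src) (stairWord i.2.1 (off i.1))) +
          walkSum Y (walk (walkEnd (emb c.src) (stairWord i.2.1 (off i.1))) (List.replicate P.L (c.dir, true))) -
          walkSum Y (walk (emb c.tgt) (stairWord i.2.2 (off i.1)))) - ∑ _i : Idx P, (S - 1) + ∑ i, E i := by
      rw [← Finset.sum_sub_distrib, ← Finset.sum_add_distrib]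
      refine Finset.sum_congr rfl fun i _ => ?_
      simp only [hE]; abel
    rw [hsum, smul_add, smul_sub, mean_const, linAvg_def]
  -- `Ū(c) = κ_c · S`
  have hU' : ((avgFun (expMeanLogSU (n := n)) U c : Matrix.specialUnitaryGroup n ℂ) : Matrix n n ℂ) =
      ((corr (expMeanLogSU (n := n)) U c : Matrix.specialUnitaryGroup n ℂ) : Matrix n n ℂ) * S := by
    rw [hSdef, ← Submonoid.coe_mul]; rfl
  set κ : Matrix n n ℂ := ((corr (expMeanLogSU (n := n)) U c : Matrix.specialUnitaryGroup n ℂ) : Matrix n n ℂ) with hκdef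
  set M : Matrix n n ℂ := ((Fintype.card (Idx P) : ℂ))⁻¹ •
    ∑ i, (((loopHol U c i : Matrix.specialUnitaryGroup n ℂ) : Matrix n n ℂ) - 1) with hM
  have e : κ * S - 1 - linAvg Y c = (κ - 1) * (S - 1) + (κ - 1 - M) + (M - linAvg Y c + (S - 1)) := by noncomm_ring
  have hM' : M - linAvg Y c + (S - 1) = ((Fintype.card (Idx P) : ℂ))⁻¹ • ∑ i, E i := by rw [hmean]; abel
  rw [hU', e, hM']
  have hθ2 : θ ^ 2 = 4 * (ℓ * δ) ^ 2 := by rw [hθ]; ring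
  calc ‖(κ - 1) * (S - 1) + (κ - 1 - M) + ((Fintype.card (Idx P) : ℂ))⁻¹ • ∑ i, E i‖
      ≤ ‖κ - 1‖ * ‖S - 1‖ + ‖κ - 1 - M‖ + ‖((Fintype.card (Idx P) : ℂ))⁻¹ • ∑ i, E i‖ :=
        (norm_add_le _ _).trans (add_le_add ((norm_add_le _ _).trans (add_le_add (norm_mul_le _ _) le_rfl)) le_rfl)
    _ ≤ 2 * θ * θ + 6 * θ ^ 2 + 49 * (ℓ * δ) ^ 2 :=
        add_le_add (add_le_add (mul_le_mul hκ1 hS1 (norm_nonneg _) (by positivity)) hκ) (norm_mean_le hEi)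
    _ = 81 * (ℓ * δ) ^ 2 := by rw [hθ2]; ring

end Main


/-! ## §5 (v1.1) The main term identified: `Q₁Y = L·QY − d(λ̄_Y)` with the straight-line block average `Q` of record -/

section MainTerm

open T4Continuum BlockAveraging AveragingRT LatticeFieldCalculus

variable {P : Params} {j : ℕ} {V : Type*} [AddCommGroup V]

/-- **TELESCOPING**: the signed sum of a GRADIENT `(dλ)_b = λ(b₊) − λ(b₋)` along a walk is `λ(end) − λ(start)` («`(∂λ)([x, x + n e_μ]) = λ(x + n e_μ) − λ(x)`» for
straight contours; here for arbitrary walks). [cite: Balaban1984PropagatorsI, (1.9) p.19] -/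
theorem walkSum_grad (lam : Site P j → V) :
    ∀ (x : Site P j) (w : List (Letter P.d)),
      walkSum (fun b : PBond P j => lam b.tgt - lam b.src) (walk x w) = lam (walkEnd x w) - lam x
  | x, [] => by simp [walk, walkEnd]
  | x, (μ, true) :: w => by
    simp only [walk, walkEnd, walkSum_cons, ↓reduceIte]
    rw [walkSum_grad lam (x.shift μ) w]
    simp only [PBond.tgt]
    abel
  | x, (μ, false) :: w => by
    have hus : (x.unshift μ).shift μ = x := by
      funext ν
      by_cases h : ν = μ
      · subst h
        simp
      · simp [Site.shift_apply, Site.unshift_apply, h]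
    simp only [walk, walkEnd, walkSum_cons, Bool.false_eq_true, ↓reduceIte]
    rw [walkSum_grad lam (x.unshift μ) w]
    simp only [PBond.tgt, hus]
    abel

/-- One step along `+e_μ` re-bases the straight contour: `runBond (x + e_μ) μ t = runBond x μ (t+1)`. [cite: Balaban1984PropagatorsI, (1.7) p.18 (bookkeeping)] -/
theorem runBond_shift (x : Site P j) (μ : Fin P.d) (t : ℕ) : runBond (x.shift μ) μ t = runBond x μ (t + 1) := by
  simp only [runBond, runSite, Site.shift, Function.update_self, Function.update_idem, PBond.mk.injEq, and_true]
  congr 1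
  push_cast
  ring

/-- **STRAIGHT WALKS ARE THE STRAIGHT CONTOURS OF RECORD**: the signed sum along the walk of `m` steps `+e_μ` from `x` is
`LatticeFieldCalculus.segSum` (`A([x, x + m e_μ]) = Σ_{t<m} A(⟨x + t e_μ, μ⟩)`). [cite: Balaban1984PropagatorsI, (1.8) p.19] -/
theorem walkSum_walk_replicate (Y : PBond P j → V) (μ : Fin P.d) :
    ∀ (m : ℕ) (x : Site P j), walkSum Y (walk x (List.replicate m (μ, true))) = segSum Y x μ m
  | 0, x => by simp [walk, segSum]
  | m + 1, x => by
    rw [List.replicate_succ]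
    simp only [walk, walkSum_cons, ↓reduceIte]
    rw [walkSum_walk_replicate Y μ m (x.shift μ), segSum, segSum, Finset.sum_range_succ', add_comm]
    simp only [runBond_shift]
    simp [runBond]

/-- **THE STAIRCASES OF (0.3) END AT THE BLOCK SITES OF RECORD**: `walkEnd (emb y) Γ^σ(n(r)) = Site.blockSite y r` (centre `yL + (L−1)/2` plus the
centred offset `r − (L−1)/2` is the lowest label `yL` plus `r`). [cite: Balaban1987RG1, (0.3) p.252] -/
theorem walkEnd_emb_stairWord_eq_blockSite (y : Site P (j + 1)) (σ : Equiv.Perm (Fin P.d)) (r : Fin P.d → Fin P.L) :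
    walkEnd (emb y) (stairWord σ (off r)) = Site.blockSite y r := by
  funext κ
  rw [BlockAveragingEMLProp2.walkEnd_stairWord_apply]
  simp only [emb, Site.blockSite, off, Int.cast_sub, Int.cast_natCast, Nat.cast_add, Nat.cast_mul]
  ring

variable {n : Type*}

/-- **THE BLOCK MEAN OF THE COMB SUMS** `λ̄_Y(y) = |I|⁻¹ Σ_{(n,σ,σ′)∈I} Y(Γ^σ_{y→y+n})` (the mean over the sites of `B(y)` and the orderings of
the signed sums of `Y` along the staircases of (0.3) from the centre): the linearisation of the coarse gauge transformation `v(y)` of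
[Balaban1985Averaging] (62) which (63)∕(93) factor out of `V̄₁V̄₀⁻¹`. [cite: Balaban1985Averaging, (62) p.28] -/
def combMean (Y : PBond P j → Matrix n n ℂ) (y : Site P (j + 1)) : Matrix n n ℂ :=
  ((Fintype.card (Idx P) : ℂ))⁻¹ • ∑ i : Idx P, walkSum Y (walk (emb y) (stairWord i.2.1 (off i.1)))

/-- `combMean` unfolded. [cite: Balaban1985Averaging, (62) p.28] -/
theorem combMean_def (Y : PBond P j → Matrix n n ℂ) (y : Site P (j + 1)) :
    combMean Y y = ((Fintype.card (Idx P) : ℂ))⁻¹ • ∑ i : Idx P, walkSum Y (walk (emb y) (stairWord i.2.1 (off i.1))) := rfl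

/-- The second ordering `σ′` is a dummy relabelling of the first: summing a function of `(n, σ′)` over `I` equals summing it over `(n, σ)`.
[cite: Balaban1987RG1, (0.4) p.253 (bookkeeping)] -/
theorem sum_idx_swap {M : Type*} [AddCommMonoid M] (f : (Fin P.d → Fin P.L) → Equiv.Perm (Fin P.d) → M) :
    ∑ i : Idx P, f i.1 i.2.2 = ∑ i : Idx P, f i.1 i.2.1 := by
  refine Fintype.sum_equiv ((Equiv.refl _).prodCongr (Equiv.prodComm _ _)) _ _ fun i => ?_
  rfl

/-- Summing a function of the offset alone over `I = {offsets} × S_d × S_d` gives `|S_d|²` copies of the offset sum. [cite: Balaban1987RG1, (0.4) p.253 (bookkeeping)] -/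
theorem sum_idx_of_fst {M : Type*} [AddCommMonoid M] (g : (Fin P.d → Fin P.L) → M) :
    ∑ i : Idx P, g i.1 = (Fintype.card (Equiv.Perm (Fin P.d)) ^ 2) • ∑ r : Fin P.d → Fin P.L, g r := by
  rw [Fintype.sum_prod_type]
  simp only [Finset.sum_const, Finset.card_univ, Fintype.card_prod, Finset.smul_sum, sq]

/-- `|I| = L^d·|S_d|²`. [cite: Balaban1987RG1, (0.4) p.253 (bookkeeping)] -/
theorem card_idx : Fintype.card (Idx P) = P.L ^ P.d * Fintype.card (Equiv.Perm (Fin P.d)) ^ 2 := by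
  simp only [Idx, Fintype.card_prod, Fintype.card_fun, Fintype.card_fin, sq]

/-- **THE LINEARISED (0.4) AVERAGE IS THE STRAIGHT-LINE BLOCK AVERAGE OF RECORD MINUS A COARSE GRADIENT**:
`(Q₁Y)(c) = L·(QY)(c) − (λ̄_Y(c₊) − λ̄_Y(c₋))` with `Q = LatticeFieldCalculus.bondAvg` ([Balaban1984PropagatorsI] (1.11); its `k`-fold iterate is the
`Q_k` of (1.18), `bondAvgIter`) and `λ̄_Y = combMean Y` — at the flat background the derivative of the (0.4) average differs from the main term (125)
exactly by the (linearised) coarse gauge transformation of [Balaban1985Averaging] (62)–(63); in particular the two agree on coarse-gauge-fixed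
perturbations (`λ̄_Y` constant) and `Q₁` kills every `dλ` with `λ` vanishing at the block centres (`linAvg_grad`). [cite: Balaban1985Averaging, (124)-(125) p.36] -/
theorem linAvg_eq_bondAvg_sub_grad_combMean (Y : PBond P j → Matrix n n ℂ) (c : PBond P (j + 1)) :
    linAvg Y c = ((P.L : ℕ) : ℂ) • bondAvg Y c - (combMean Y c.tgt - combMean Y c.src) := by
  -- the three families of terms
  have hsplit : linAvg Y c = ((Fintype.card (Idx P) : ℂ))⁻¹ • ∑ i : Idx P, walkSum Y (walk (emb c.src) (stairWord i.2.1 (off i.1))) +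
      ((Fintype.card (Idx P) : ℂ))⁻¹ • ∑ i : Idx P,
        walkSum Y (walk (walkEnd (emb c.src) (stairWord i.2.1 (off i.1))) (List.replicate P.L (c.dir, true))) -
      ((Fintype.card (Idx P) : ℂ))⁻¹ • ∑ i : Idx P, walkSum Y (walk (emb c.tgt) (stairWord i.2.2 (off i.1))) := by
    rw [linAvg_def, ← smul_add, ← smul_sub, ← Finset.sum_add_distrib, ← Finset.sum_sub_distrib]
  -- the straight terms are `segSum` at the block sites of record, a function of the offset alone
  have hstraight : ∑ i : Idx P, walkSum Y (walk (walkEnd (emb c.src) (stairWord i.2.1 (off i.1))) (List.replicate P.L (c.dir, true))) =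
      (Fintype.card (Equiv.Perm (Fin P.d)) ^ 2) • ∑ r : Fin P.d → Fin P.L, segSum Y (Site.blockSite c.src r) c.dir P.L := by
    rw [← sum_idx_of_fst]
    refine Finset.sum_congr rfl fun i _ => ?_
    rw [walkEnd_emb_stairWord_eq_blockSite, walkSum_walk_replicate]
  -- the second staircase family is the comb mean at `c₊`
  have hσ' : ∑ i : Idx P, walkSum Y (walk (emb c.tgt) (stairWord i.2.2 (off i.1))) =
      ∑ i : Idx P, walkSum Y (walk (emb c.tgt) (stairWord i.2.1 (off i.1))) :=
    sum_idx_swap fun r σ => walkSum Y (walk (emb c.tgt) (stairWord σ (off r)))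
  -- the normalisation of the straight terms: `|I|⁻¹·|S_d|²·Σ_r = L·L^{−(d+1)}·Σ_r`
  have hL : (P.L : ℂ) ≠ 0 := Nat.cast_ne_zero.mpr P.L_pos.ne'
  have hS : (Fintype.card (Equiv.Perm (Fin P.d)) : ℂ) ≠ 0 := Nat.cast_ne_zero.mpr Fintype.card_pos.ne'
  have hnorm : ((Fintype.card (Idx P) : ℂ))⁻¹ • ((Fintype.card (Equiv.Perm (Fin P.d)) ^ 2) •
      ∑ r : Fin P.d → Fin P.L, segSum Y (Site.blockSite c.src r) c.dir P.L) = ((P.L : ℕ) : ℂ) • bondAvg Y c := by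
    rw [bondAvg, RCLike.real_smul_eq_coe_smul (K := ℂ), smul_smul, ← Nat.cast_smul_eq_nsmul ℂ, smul_smul, card_idx]
    congr 1
    push_cast
    field_simp
    ring
  rw [hsplit, hstraight, hnorm, hσ', ← combMean_def, ← combMean_def]
  abel

/-- **LINEARISED COVARIANCE**: on a gradient `(dλ)_b = λ(b₊) − λ(b₋)` the linearised average is the COARSE gradient of `λ` read at the block centres,
`Q₁(dλ)(c) = λ(emb c₊) − λ(emb c₋)`; in particular `Q₁(dλ) = 0` whenever `λ` vanishes at the centres (the (0.4) average is invariant under fine gauge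
transformations that are trivial on the coarse lattice, [Balaban1985Averaging] (11)). [cite: Balaban1985Averaging, (11) p.18] -/
theorem linAvg_grad (lam : Site P j → Matrix n n ℂ) (c : PBond P (j + 1)) :
    linAvg (fun b : PBond P j => lam b.tgt - lam b.src) c = lam (emb c.tgt) - lam (emb c.src) := by
  rw [linAvg_def]
  have hterm : ∀ i : Idx P,
      walkSum (fun b : PBond P j => lam b.tgt - lam b.src) (walk (emb c.src) (stairWord i.2.1 (off i.1))) +
        walkSum (fun b : PBond P j => lam b.tgt - lam b.src)
          (walk (walkEnd (emb c.src) (stairWord i.2.1 (off i.1))) (List.replicate P.L (c.dir, true))) -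
        walkSum (fun b : PBond P j => lam b.tgt - lam b.src) (walk (emb c.tgt) (stairWord i.2.2 (off i.1))) =
      lam (emb c.tgt) - lam (emb c.src) := by
    intro i
    rw [walkSum_grad, walkSum_grad, walkSum_grad, BlockAveragingEMLProp2.walkEnd_stairWord_replicate c.src c.dir i.2.1 i.2.2 (off i.1)]
    rw [show c.src.shift c.dir = c.tgt from rfl]
    abel
  simp_rw [hterm]
  haveI : Nonempty (Idx P) := inferInstance
  have hc : (Fintype.card (Idx P) : ℂ) ≠ 0 := Nat.cast_ne_zero.mpr Fintype.card_pos.ne'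
  rw [Finset.sum_const, Finset.card_univ, ← Nat.cast_smul_eq_nsmul ℂ, smul_smul, inv_mul_cancel₀ hc, one_smul]

end MainTerm

end Literature.MathematicalPhysics.QuantumFieldTheory.Balaban1983to89.BlockAveragingEMLLinearised

end
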